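import Literature.AlgebraicGeometry.FundamentalGroup.RiemannExistenceCovering
import Literature.AlgebraicGeometry.FundamentalGroup.FiniteEtaleNilpotentLift
import Literature.AlgebraicGeometry.Motives.AlgPointsNilpotentThickening
import Literature.AlgebraicGeometry.Morphisms.RefinedValuativeCriterionDense
import Literature.AlgebraicGeometry.HodgeTheory.MotivatedClassesDeformationInputs
import Mathlib.AlgebraicGeometry.Noetherian
import Mathlib.RingTheory.Noetherian.Nilpotent
import HarnessLib

/-!
# Riemann's existence theorem for finite coverings: reduction along nilpotent thickenings

Topic `Literature/AlgebraicGeometry/FundamentalGroup` (SGA 1 XII); theorems only. The first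
reduction in Grothendieck's proof of the essential surjectivity in Riemann's existence theorem
(SGA 1 XII Thm. 5.1, part 2 a)): «On peut évidemment supposer `X` réduit». Precisely
(`riemannExistence_finiteCovering_of_thickening`): if `i : S₀ ⟶ S` is a morphism of `ℂ`-schemes
which is a surjective closed immersion whose kernel is nilpotent on every affine open (e.g.
`S_red ↪ S` for `S` locally Noetherian), and every finite-fibred covering space of `S₀(ℂ)` is
`S'₀(ℂ)` for a finite étale `S'₀ → S₀`, then every finite-fibred covering space of `S(ℂ)` is
`S'(ℂ)` for a finite étale `S' → S`. Ingredients, all in the tree: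

* `S₀(ℂ) → S(ℂ)` is a homeomorphism (`Motives/AlgPointsNilpotentThickening`: «`X^an` et `X_red^an`
  ont même espace topologique sous-jacent»);
* finite étale covers lift along nilpotent thickenings, with a surjective closed immersion
  `S'₀ ↪ S'` over `i` (SGA 1 I 8.3, `FiniteEtaleNilpotentLift`; «en vertu de IX 4.10 le
  foncteur analogue … est une équivalence»), so that again `S'₀(ℂ) ≅ S'(ℂ)`.

The case `S₀ = S_red` (`riemannExistence_finiteCovering_of_red`, for `S` locally Noetherian, with
`S_red = Over.mk (S.left.nilradical.subschemeι ≫ S.hom)` over `ℂ`; reducedness and surjectivity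
of `S_red ↪ S` are the tree's `Morphisms/RefinedValuativeCriterionDense`) closes step a) of
part 2 of the proof attached to the named fact `riemannExistence_finiteCovering`
(`RiemannExistenceCovering.lean`):
`riemannExistence_finiteCovering_of_reduced` — **the named fact follows from its restriction to
REDUCED quasi-projective `S`** (`S_red` is quasi-projective by the tree's
`IsQuasiProjectiveOver.of_isClosedImmersion`). The remaining steps (normalisation descent IX 4.7,
and the analytic core XII 5.3–5.4 with GAGA) are not in the tree.

## References

* [SGA1] A. Grothendieck, M. Raynaud, *SGA 1* (LNM 224 / arXiv:math/0206203), Exp. XII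
  Thm. 5.1 and its proof (pp. 332–334 of the original; p0184 of the materialised text); Exp. I
  Thm. 8.3; Exp. IX 4.10.

#harness_tags algebraic_geometry.sga1, hodge.stub_C1
-/

noncomputable section

open CategoryTheory CategoryTheory.Limits AlgebraicGeometry
open _root_.Topology

namespace Literature.AlgebraicGeometry.FundamentalGroup

open Literature.AlgebraicGeometry.Motives Literature.AlgebraicGeometry.Motives.AlgPoints
open Literature.AlgebraicGeometry.HodgeTheory

/-- **Riemann's existence theorem for finite coverings passes along nilpotent thickenings**
(SGA 1 XII 5.1, proof, part 2 a): «on peut évidemment supposer `X` réduit»). Let `i : S₀ ⟶ S`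
be a morphism of `ℂ`-schemes which is a surjective closed immersion with affine-locally
nilpotent kernel (e.g. `S_red ↪ S`). If every finite-fibred covering space of `S₀(ℂ)` is the space
of complex points of a finite étale `S₀`-scheme, then the same holds for `S`: `S₀(ℂ) → S(ℂ)` is a
homeomorphism (`AlgPoints.isHomeomorph_map_of_isClosedImmersion_of_surjective`), a finite étale
`S'₀ → S₀` realising the covering lifts to a finite étale `S' → S` with `S'₀ ↪ S'` a surjective
closed immersion (SGA 1 I 8.3, `exists_finite_etale_lift_of_thickening`), and
`S'(ℂ) ≅ S'₀(ℂ) ≅ T` over `S(ℂ) ≅ S₀(ℂ)`.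
[cite: SGA1, Exp. XII Thm. 5.1 (proof, part 2 a)), with Exp. I Thm. 8.3 and Exp. IX 4.10] -/
theorem riemannExistence_finiteCovering_of_thickening {S S₀ : Motives.SchemeOver ℂ} (i : S₀ ⟶ S)
    [IsClosedImmersion i.left] [Surjective i.left]
    (hi : ∀ U : S.left.affineOpens, IsNilpotent (RingHom.ker (i.left.app U).hom))
    (h₀ : ∀ (T : Type) [TopologicalSpace T] (q : T → Motives.ComplexPoints S₀),
      IsCoveringMap q → (∀ t, (q ⁻¹' {t}).Finite) →
      ∃ (S' : Motives.SchemeOver ℂ) (g : S' ⟶ S₀) (Φ : Motives.ComplexPoints S' ≃ₜ T),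
        IsFinite g.left ∧ Etale g.left ∧ ∀ z, q (Φ z) = Motives.AlgPoints.map g z)
    (T : Type) [TopologicalSpace T] (q : T → Motives.ComplexPoints S) (hq : IsCoveringMap q)
    (hfin : ∀ t, (q ⁻¹' {t}).Finite) :
    ∃ (S' : Motives.SchemeOver ℂ) (g : S' ⟶ S) (Φ : Motives.ComplexPoints S' ≃ₜ T),
      IsFinite g.left ∧ Etale g.left ∧ ∀ z, q (Φ z) = Motives.AlgPoints.map g z := by
  -- `S₀(ℂ) ≅ S(ℂ)`
  let E : Motives.ComplexPoints S₀ ≃ₜ Motives.ComplexPoints S :=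
    (isHomeomorph_map_of_isClosedImmersion_of_surjective (L := ℂ) i).homeomorph
  have hE : ∀ x, E x = map i x := fun _ ↦ rfl
  -- the covering `q₀ = E⁻¹ ∘ q` of `S₀(ℂ)`
  let q₀ : T → Motives.ComplexPoints S₀ := E.symm ∘ q
  have hq₀ : IsCoveringMap q₀ := hq.homeomorph_comp E.symm
  have hfin₀ : ∀ t, (q₀ ⁻¹' {t}).Finite := fun t ↦ by
    have : q₀ ⁻¹' {t} = q ⁻¹' {E t} := by
      ext x
      simp only [q₀, Set.mem_preimage, Function.comp_apply, Set.mem_singleton_iff]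
      rw [Homeomorph.symm_apply_eq]
    rw [this]
    exact hfin (E t)
  obtain ⟨S'₀, g₀, Φ₀, hfin', het', hq₀Φ⟩ := h₀ T q₀ hq₀ hfin₀
  haveI := hfin'
  haveI := het'
  -- lift `g₀` along the thickening
  obtain ⟨S'l, g, j, hg₁, hg₂, hj₁, hj₂, hjg⟩ :=
    exists_finite_etale_lift_of_thickening i.left hi g₀.left
  let S' : Motives.SchemeOver ℂ := Over.mk (g ≫ S.hom)
  let gO : S' ⟶ S := Over.homMk g rfl
  let jO : S'₀ ⟶ S' := Over.homMk j (by
    change j ≫ g ≫ S.hom = S'₀.hom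
    rw [← Category.assoc, hjg, Category.assoc, Over.w i, Over.w g₀])
  have hjOg : jO ≫ gO = g₀ ≫ i := by
    ext : 1
    exact hjg
  haveI : IsClosedImmersion jO.left := hj₁
  haveI : Surjective jO.left := hj₂
  let J : Motives.ComplexPoints S'₀ ≃ₜ Motives.ComplexPoints S' :=
    (isHomeomorph_map_of_isClosedImmersion_of_surjective (L := ℂ) jO).homeomorph
  have hJ : ∀ x, J x = map jO x := fun _ ↦ rfl
  refine ⟨S', gO, J.symm.trans Φ₀, hg₁, hg₂, fun z ↦ ?_⟩
  obtain ⟨z₀, rfl⟩ := J.surjective z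
  rw [Homeomorph.trans_apply, Homeomorph.symm_apply_apply]
  have h1 : q (Φ₀ z₀) = E (q₀ (Φ₀ z₀)) := by
    simp only [q₀, Function.comp_apply, Homeomorph.apply_symm_apply]
  rw [h1, hq₀Φ, hE, hJ, ← map_comp_apply, ← map_comp_apply, hjOg]

/-! ### The case `S₀ = S_red` -/

/-- The kernel of `Γ(X, U) → Γ(X_red, U)` on an affine open is the nilradical. [folklore] -/
theorem ker_nilradical_subschemeι_app (X : Scheme) (U : X.affineOpens) :
    RingHom.ker (X.nilradical.subschemeι.app U).hom = nilradical Γ(X, U) := by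
  rw [Scheme.IdealSheafData.ker_subschemeι_app]
  simp [Scheme.nilradical, nilradical]

/-- For `X` locally Noetherian the kernels of `Γ(X, U) → Γ(X_red, U)` on affine opens are
nilpotent. [folklore] -/
theorem isNilpotent_ker_nilradical_subschemeι_app (X : Scheme) [IsLocallyNoetherian X]
    (U : X.affineOpens) : IsNilpotent (RingHom.ker (X.nilradical.subschemeι.app U).hom) := by
  rw [ker_nilradical_subschemeι_app]
  haveI : IsNoetherianRing Γ(X, U) := IsLocallyNoetherian.component_noetherian U
  exact IsNoetherianRing.isNilpotent_nilradical _

/-- **«On peut évidemment supposer `X` réduit»** (SGA 1 XII 5.1, proof, part 2 a)): for `S`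
locally Noetherian over `ℂ`, Riemann's existence theorem for finite coverings of `S_red(ℂ)`
implies it for `S(ℂ)`. [cite: SGA1, Exp. XII Thm. 5.1 (proof, part 2 a))] -/
theorem riemannExistence_finiteCovering_of_red (S : Motives.SchemeOver ℂ)
    [IsLocallyNoetherian S.left]
    (h₀ : ∀ (T : Type) [TopologicalSpace T]
      (q : T → Motives.ComplexPoints (Over.mk (S.left.nilradical.subschemeι ≫ S.hom))),
      IsCoveringMap q → (∀ t, (q ⁻¹' {t}).Finite) →
      ∃ (S' : Motives.SchemeOver ℂ) (g : S' ⟶ Over.mk (S.left.nilradical.subschemeι ≫ S.hom))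
        (Φ : Motives.ComplexPoints S' ≃ₜ T),
        IsFinite g.left ∧ Etale g.left ∧ ∀ z, q (Φ z) = Motives.AlgPoints.map g z)
    (T : Type) [TopologicalSpace T] (q : T → Motives.ComplexPoints S) (hq : IsCoveringMap q)
    (hfin : ∀ t, (q ⁻¹' {t}).Finite) :
    ∃ (S' : Motives.SchemeOver ℂ) (g : S' ⟶ S) (Φ : Motives.ComplexPoints S' ≃ₜ T),
      IsFinite g.left ∧ Etale g.left ∧ ∀ z, q (Φ z) = Motives.AlgPoints.map g z :=
  -- `S_red ↪ S` over `ℂ`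
  let ι : Over.mk (S.left.nilradical.subschemeι ≫ S.hom) ⟶ S :=
    Over.homMk S.left.nilradical.subschemeι rfl
  haveI : IsClosedImmersion ι.left :=
    inferInstanceAs (IsClosedImmersion S.left.nilradical.subschemeι)
  haveI : Surjective ι.left := inferInstanceAs (Surjective S.left.nilradical.subschemeι)
  riemannExistence_finiteCovering_of_thickening ι
    (fun U ↦ isNilpotent_ker_nilradical_subschemeι_app S.left U) h₀ T q hq hfin

/-- **Riemann's existence theorem for finite coverings reduces to REDUCED quasi-projective
schemes** (SGA 1 XII 5.1, proof, part 2 a): «On peut évidemment supposer `X` réduit»): the named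
fact `riemannExistence_finiteCovering` follows from its restriction to reduced `S`. (A
quasi-projective `ℂ`-scheme is locally Noetherian, `S_red ↪ S` is a closed immersion so `S_red` is
again quasi-projective — the tree's `IsQuasiProjectiveOver.of_isClosedImmersion` — and
`riemannExistence_finiteCovering_of_red` applies.)
[cite: SGA1, Exp. XII Thm. 5.1 (proof, part 2 a))] -/
theorem riemannExistence_finiteCovering_of_reduced
    (h : ∀ (S : Motives.SchemeOver ℂ), IsQuasiProjectiveOver S → IsReduced S.left →
      ∀ (T : Type) [TopologicalSpace T] (q : T → Motives.ComplexPoints S),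
        IsCoveringMap q → (∀ t, (q ⁻¹' {t}).Finite) →
        ∃ (S' : Motives.SchemeOver ℂ) (g : S' ⟶ S) (Φ : Motives.ComplexPoints S' ≃ₜ T),
          IsFinite g.left ∧ Etale g.left ∧ ∀ z, q (Φ z) = Motives.AlgPoints.map g z) :
    riemannExistence_finiteCovering := by
  intro S hS T _ q hq hfin
  haveI : LocallyOfFiniteType S.hom := hS.locallyOfFiniteType
  haveI : IsLocallyNoetherian S.left := LocallyOfFiniteType.isLocallyNoetherian S.hom
  let Sred : Motives.SchemeOver ℂ := Over.mk (S.left.nilradical.subschemeι ≫ S.hom)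
  let ι : Sred ⟶ S := Over.homMk S.left.nilradical.subschemeι rfl
  haveI : IsClosedImmersion ι.left :=
    inferInstanceAs (IsClosedImmersion S.left.nilradical.subschemeι)
  haveI : IsReduced Sred.left := inferInstanceAs (IsReduced S.left.nilradical.subscheme)
  exact riemannExistence_finiteCovering_of_red S
    (fun T' _ q' hq' hfin' ↦ h Sred (hS.of_isClosedImmersion ι) inferInstance T' q' hq' hfin')
    T q hq hfin

end Literature.AlgebraicGeometry.FundamentalGroup

end
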